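import Summits.HodgeConjecture.HodgeConjecture.Theorems.Ring2AbelianAllAndreOddCellKTopLines
import HarnessLib

/-!
# Ring 2 · AbelianAll — ANDRÉ AXIS, PART U — U-d: THE TWISTED SQUARE AT A MEMBER — swap chart, weight-one discriminant for any factor embedding, and THE LINE SWAP `⋀³V₋(ψ) = ⋀³V₊(−ψ)` (Sketch §F1, §F3, §I (P0), AV level)

HONEST FRAMING (page 1, verbatim): **research route, not a corollary; conditional on HC_CM plus one named minimal statement.** Cell line:
research route conditional on HC_CM; not a corollary; Q11.4-sentence-2 already refuted in dim ≥ 3. Nothing in this file proves a case of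
the Hodge conjecture or `B(X)` for a named `X`; `HC_CM`, `HC_AV` and the global nodes are ABSENT; every bracket / residual / crux below is a
HYPOTHESIS wherever used (`@[conjecture] def`), never asserted. Item `Theses.RankFourFaces.CMToAbelian` (stmt-16267) stays OPEN; N104 untouched.

PROVENANCE. Seat `pub-hodge-ring2-ab-andre-2`, gen 52 (PART U: the ODD CELL at relative dimension three on the André axis). The
mathematics of this part was PLANNED AND KERNEL-CHECKED AT MEMO LEVEL by the (lapsed) ideation seat vhodge-p6 (gens 0–6, 2026-08-25) in
`run/shared/lean/pub/vhodge/memos/ROUTE-P6-g4-Sketch.lean` (sha16 a5719f36; 2548 lines; farm rc 0, 0 sorries, 0 errors; re-checked by this seat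
2026-08-26T02:34Z, 60 s) on top of this seat's parts XXXV–T; it never entered the tree (the planner seat files nothing; director-hodge ruling
2026-08-25T21:26:55Z «(B) LAPSE with (A) banked»: landing the Sketch's statement vocabulary + kernel chain as Theorems files is cost item (A)(1)
of the banked ladder rung H1d′ «Lefschetz B for compact abelian-threefold pencils, odd cell»). This file is that landing for the sections named
in its title: declarations VERBATIM from the Sketch (namespace moved from `…VHodgeP6` to `…Ring2.AbelianAll.OddCell`, the memo-level `abbrev
FirstTarget` replaced by the constant `LefschetzBOddPencilsRelDimThree`, lint repairs, sections re-cut to the tree's 400-line files), credited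
decl by decl to the memo; the seat's own additions are marked «(ab-andre-2, gen 52)».

CONTENT (abelian-variety level; theorems only; Sketch lines 666–688, 757–832, 1829–2021): the projections of the swap chart `prodSwap` (part U-a); **`det H` of the twisted square
`(T × T, φ × (−φ), pr₁^*h_K + pr₂^*h_K)` is the split class for EVERY projective embedding of `T`** (`hasWeilDiscriminantNondeg_twistedSquare_weight_one`,
freeing the tree's `exists_hasWeilDiscriminantNondeg_twistedSquare` from its own embedding); the wedge-basis description of the `K`-top eigenclass
line with the eigenbasis as a PARAMETER (`pullbackEigenclasses_pow_eq_span_wedge`) and **(P0) the line swap** (`kTopLinesNegSwap_of_pos`,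
the memo's `KTopLinesNegSwap N d` inlined): the `χ₋`-line of `ψ` IS the `χ₊`-line of `−ψ` as joint-eigenclass carriers, and `+ ↔ −`. EDGE LABELS: K (fact-free).
-/

noncomputable section

namespace Summit.HodgeConjecture.HodgeConjecture.Ring2.AbelianAll.OddCell

set_option linter.dupNamespace false

open CategoryTheory CategoryTheory.Limits AlgebraicGeometry MonoidalCategory CartesianMonoidalCategory
open Literature.AlgebraicGeometry Literature.AlgebraicGeometry.Motives
open Literature.AlgebraicGeometry.HodgeTheory
open Literature.AlgebraicTopology.SingularHomology
open Literature.AlgebraicGeometry.VanGeemen1994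
open Literature.AlgebraicGeometry.Andre1996 (compactPencil_dim_eq_of_iso)
open Summit.HodgeConjecture.HodgeConjecture
open Summit.HodgeConjecture.HodgeConjecture.Theses
open Summit.HodgeConjecture.HodgeConjecture.Ring2.AbelianAll
open Summit.HodgeConjecture.HodgeConjecture.Theorems (deg_fiberGysin_aux exists_fibreClassInverse_deg_of_lefschetzBCompactPencils)
open scoped MonObj

variable {𝒳 S : SchemeOver ℂ} {f : 𝒳 ⟶ S}

/-! ## §F1  The swap chart `(A × B).X ≅ B.X × A.X` -/

/-- First projection of the swap chart. [folklore] -/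
@[reassoc (attr := simp)]
theorem prodSwap_hom_fst (A B : AbelianVariety ℂ) : (prodSwap A B).hom ≫ fst B.X A.X = (AbelianVariety.snd A B).hom.hom.hom :=
  lift_fst _ _

/-- Second projection of the swap chart. [folklore] -/
@[reassoc (attr := simp)]
theorem prodSwap_hom_snd (A B : AbelianVariety ℂ) : (prodSwap A B).hom ≫ snd B.X A.X = (AbelianVariety.fst A B).hom.hom.hom :=
  lift_snd _ _

/-- `σ^* pr₁^* = pr₂^*`. [folklore] -/
theorem map_prodSwap_hom_map_fst (A B : AbelianVariety ℂ) (k : ℕ) (y : complexBetti B.X k) :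
    complexBetti.map (prodSwap A B).hom k (complexBetti.map (fst B.X A.X) k y) =
      complexBetti.map (AbelianVariety.snd A B).hom.hom.hom k y := by
  rw [← complexBetti.map_comp_apply', prodSwap_hom_fst]

/-- `σ^* pr₂^* = pr₁^*`. [folklore] -/
theorem map_prodSwap_hom_map_snd (A B : AbelianVariety ℂ) (k : ℕ) (x : complexBetti A.X k) :
    complexBetti.map (prodSwap A B).hom k (complexBetti.map (snd B.X A.X) k x) =
      complexBetti.map (AbelianVariety.fst A B).hom.hom.hom k x := by
  rw [← complexBetti.map_comp_apply', prodSwap_hom_snd]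

/-! ## §F3  The weight-one discriminant of the twisted square, for an ARBITRARY factor embedding -/

section Discriminant

variable {T : AbelianVariety ℂ} {m₀ d : ℕ} {φ : T ⟶ T}

/-- **`det H` OF THE TWISTED SQUARE `(T × T, φ × (−φ), pr₁^*h_K + pr₂^*h_K)` IS THE SPLIT CLASS `[(−1)^g]`** for EVERY projective
embedding `e_T` of `T` (`dim T = g = m₀ + 1 ≥ 2`, `φ² = −d`, `h_K = d·e_T^*a_T + φ^*e_T^*a_T`), provided the product class is the
`K`-symmetrised class of SOME projective embedding of `T × T` (which makes the top coefficient `t ≠ 0`): one `K`-frame `(x, ω, a, b, q, t)`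
of `(T, φ, h_K)` on both factors, Gram data `(−a, b)` of determinant `(−1)^g q` for `−φ`, and `det H` multiplicative:
`(C t)^g (C t)^g · q · (−1)^g q = (−1)^g · (C^g t^g q)²`, `C = C(2g−1, g−1) = C(2g−1, g)`. The tree's
`exists_hasWeilDiscriminantNondeg_twistedSquare` at weight `m = 1`, freed from its own choice of `e_T`.
[cite: vanGeemen1994HodgeAV, Lemma 5.2 (2)–(3), 4.14 and 5.3] [cite: Markman2025SurveySecant, §11.5 Step 2] -/
theorem hasWeilDiscriminantNondeg_twistedSquare_weight_one (hm₀ : 1 ≤ m₀) (hT : T.dim = m₀ + 1) (hd : 0 < d)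
    (hφ : φ ≫ φ = -(d • 𝟙 T)) (eT : ProjectiveEmbedding T.X) {aT : complexBetti (projectiveSpace eT.n ℂ) 2}
    (haT : IsRationalClass aT) (haT0 : aT ≠ 0)
    (e : ProjectiveEmbedding (T.prod T).X) {a : complexBetti (projectiveSpace e.n ℂ) 2} (ha : IsRationalClass a) (ha0 : a ≠ 0)
    (hh : (d : ℂ) • complexBetti.map e.ι 2 a +
        complexBetti.map (AbelianVariety.prodLift (AbelianVariety.fst T T ≫ φ) (AbelianVariety.snd T T ≫ (-φ))).hom.hom.hom 2
          (complexBetti.map e.ι 2 a) =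
      complexBetti.map (AbelianVariety.fst T T).hom.hom.hom 2
          ((d : ℂ) • complexBetti.map eT.ι 2 aT + complexBetti.map φ.hom.hom.hom 2 (complexBetti.map eT.ι 2 aT)) +
        complexBetti.map (AbelianVariety.snd T T).hom.hom.hom 2
          ((d : ℂ) • complexBetti.map eT.ι 2 aT + complexBetti.map φ.hom.hom.hom 2 (complexBetti.map eT.ι 2 aT))) :
    HasWeilDiscriminantNondeg (T.prod T)
      (AbelianVariety.prodLift (AbelianVariety.fst T T ≫ φ) (AbelianVariety.snd T T ≫ (-φ))) (m₀ + 1) d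
      (complexBetti.map (AbelianVariety.fst T T).hom.hom.hom 2
          ((d : ℂ) • complexBetti.map eT.ι 2 aT + complexBetti.map φ.hom.hom.hom 2 (complexBetti.map eT.ι 2 aT)) +
        complexBetti.map (AbelianVariety.snd T T).hom.hom.hom 2
          ((d : ℂ) • complexBetti.map eT.ι 2 aT + complexBetti.map φ.hom.hom.hom 2 (complexBetti.map eT.ι 2 aT)))
      (QuotientGroup.mk ((-1 : ℚˣ) ^ (m₀ + 1))) := by
  classical
  have hψ : (-φ) ≫ (-φ) = -(d • 𝟙 T) := by rw [Preadditive.neg_comp_neg, hφ]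
  -- (1) ONE `K`-frame of `(T, φ, h_K)`
  obtain ⟨x, ω, am, bm, q, t, hx, hi, hω, hω0, hp, hq, ht⟩ := exists_kFrame_ksymm hm₀ hT hd hφ eT haT haT0
  set hK := (d : ℂ) • complexBetti.map eT.ι 2 aT + complexBetti.map φ.hom.hom.hom 2 (complexBetti.map eT.ι 2 aT)
    with hKdef
  -- (2) the frame data of the SECOND factor `(T, −φ, h_K)`: Gram `(−a, b)`, same top class and top coefficient
  have hi' : LinearIndependent ℂ (Sum.elim x (fun i => complexBetti.map (-φ).hom.hom.hom 1 (x i))) := by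
    have e1 : (fun i => complexBetti.map (-φ).hom.hom.hom 1 (x i)) =
        fun i => (-1 : ℂ) • complexBetti.map φ.hom.hom.hom 1 (x i) := by
      funext i; rw [complexBetti_map_neg_one_apply, neg_one_smul]
    rw [e1]
    exact (linearIndependent_sum_elim_smul_iff _ _ (by norm_num)).2 hi
  have hp' : ∀ i j : Fin (m₀ + 1),
      polarizationPairingOne T.X hK m₀ (x i) (complexBetti.map (-φ).hom.hom.hom 1 (x j)) = (((-am) i j : ℚ) : ℂ) • ω ∧
        polarizationPairingOne T.X hK m₀ (x i) (x j) = ((bm i j : ℚ) : ℂ) • ω := by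
    intro i j
    obtain ⟨h1, h2⟩ := hp i j
    refine ⟨?_, h2⟩
    rw [complexBetti_map_neg_one_apply, map_neg, h1, Matrix.neg_apply, Rat.cast_neg, neg_smul]
  have hq' : (weilGramMatrix d (-am) bm).det =
      algebraMap ℚ (weilField d) ((((-1 : ℚˣ) ^ (m₀ + 1) * q : ℚˣ) : ℚ)) := by
    rw [det_weilGramMatrix_neg_left_of_det_eq d hq]
    push_cast
    rfl
  -- (3) top coefficients do not vanish; the product witness
  have hN : 2 * (m₀ + 1) = m₀ + m₀ + 2 := by ring
  obtain ⟨ht0, -⟩ := prod_kFrames_top_ne_zero hT hT hN (kA := m₀ + 1) (kB := m₀ + 1) (by omega) (by omega)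
    (by omega) hd hφ hψ x hx hi hK ω am bm hp t ht x hx hi' hK ω (-am) bm hp' t ht e ha ha0 hh
  let ε : Fin (m₀ + 1) ⊕ Fin (m₀ + 1) ≃ Fin (2 * (m₀ + 1)) := finSumFinEquiv.trans (finCongr (by omega))
  have hδ := hasWeilDiscriminantNondeg_prod_of_kFrames hT hT hN ε x hx hi hK ω hω hω0 am bm hp t ht ht0 q hq
    x hx hi' hK ω hω hω0 (-am) bm hp' t ht ht0 ((-1 : ℚˣ) ^ (m₀ + 1) * q) hq'
  -- (4) the class: `(C t)^g (C' t)^g · q · (−1)^g q = (−1)^g (C^g t^g q)²`, `C = C'`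
  have hC : (((2 * (m₀ + 1) - 1).choose (m₀ + 1) : ℕ) : ℚ) = (((2 * (m₀ + 1) - 1).choose m₀ : ℕ) : ℚ) := by
    rw [show 2 * (m₀ + 1) - 1 = 2 * m₀ + 1 by omega, Nat.choose_symm_half]
  have hC0 : (((2 * (m₀ + 1) - 1).choose m₀ : ℕ) : ℚ) ≠ 0 :=
    Nat.cast_ne_zero.2 (Nat.choose_pos (by omega)).ne'
  have ht0' : t ≠ 0 := ht0
  set u : ℚˣ := Units.mk0 ((((2 * (m₀ + 1) - 1).choose m₀ : ℕ) : ℚ) * t) (mul_ne_zero hC0 ht0') ^ (m₀ + 1) * q with hu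
  rw [weilNormResidueGroup_mk_eq_mk_of_val_eq (w := (-1 : ℚˣ) ^ (m₀ + 1)) u ?_] at hδ
  · exact hδ
  simp only [hu, Units.val_mul, Units.val_pow_eq_pow_val, Units.val_neg, Units.val_one, Units.val_mk0, hC]
  ring

end Discriminant

/-- **§I-P0 (generalised §G `key`, eigenbasis as a PARAMETER)**: for ANY `φ^*`-eigenbasis `b` of `H¹` with eigenvalues `lam i ∈ {mu, −mu}`
(`mu ≠ 0`) and the `N`-subset `S₀` of the `mu`-indices, the joint eigenclasses of character `(x + y·mu)^N` in degree `N` are the LINE through the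
wedge `Bw S₀`, `Bw = ⋀^N b`. Two applications — to `φ` and to `−φ` with the SAME `b` — give comparable lines (this is (P0)).
[cite: vanGeemen1994HodgeAV, 4.9 and proof of Thm. 6.12] -/
theorem pullbackEigenclasses_pow_eq_span_wedge {M N : ℕ} {A : AbelianVariety ℂ} (hΛ : HasExteriorCohomologyH1 ℂ (Motives.ComplexPoints A.X))
    {φ : A ⟶ A} {mu : ℂ} (hmu0 : mu ≠ 0) (b : Module.Basis (Fin M) ℂ (complexBetti A.X 1)) (lam : Fin M → ℂ)
    (hlam : ∀ i, lam i = mu ∨ lam i = -mu)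
    (hb_mem : ∀ i, b i ∈ Module.End.eigenspace (complexBetti.map φ.hom.hom.hom 1).hom (lam i))
    (S₀ : Set.powersetCard (Fin M) N) (hS₀ : ∀ i, i ∈ S₀ ↔ lam i = mu) :
    (pullbackEigenclasses A φ N fun x y => ((x : ℂ) + (y : ℂ) * mu) ^ N) = ℂ ∙ ((b.exteriorPower N).map (hΛ.equiv N)) S₀ := by
  classical
  set Bw : Module.Basis (Set.powersetCard (Fin M) N) ℂ (complexBetti A.X N) := (b.exteriorPower N).map (hΛ.equiv N) with hBw_def
  have hBw : ∀ S, Bw S = cupPowOne ℂ (Motives.ComplexPoints A.X) N (b ∘ (Set.powersetCard.ofFinEmbEquiv.symm S)) := by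
    intro S
    rw [hBw_def, Module.Basis.map_apply, exteriorPower.basis_apply, HasExteriorCohomologyH1.equiv_apply, exteriorPower.ιMulti_family,
      wedgeToCup_ιMulti]
  have hact : ∀ (p : ℕ × ℕ) (S : Set.powersetCard (Fin M) N),
      (complexBetti.map (p.1 • 𝟙 A + p.2 • φ).hom.hom.hom N).hom (Bw S) =
        (∏ i : Fin N, ((p.1 : ℂ) + (p.2 : ℂ) * lam (Set.powersetCard.ofFinEmbEquiv.symm S i))) • Bw S := by
    rintro ⟨x, y⟩ S
    rw [hBw]
    change singularCohomology.map ℂ ℂ (Motives.AlgPoints.mapContinuous (L := ℂ) (x • 𝟙 A + y • φ).hom.hom.hom) N (cupPowOne ℂ _ N _) = _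
    rw [map_cupPowOne]
    have e : (fun i => singularCohomology.map ℂ ℂ (Motives.AlgPoints.mapContinuous (L := ℂ) (x • 𝟙 A + y • φ).hom.hom.hom) 1
          ((b ∘ (Set.powersetCard.ofFinEmbEquiv.symm S)) i)) =
        fun i => ((x : ℂ) + (y : ℂ) * lam (Set.powersetCard.ofFinEmbEquiv.symm S i)) • (b ∘ (Set.powersetCard.ofFinEmbEquiv.symm S)) i := by
      funext i
      exact complexBetti_map_nsmul_id_add_nsmul_one_of_mem_eigenspace (hb_mem _) x y
    rw [e, MultilinearMap.map_smul_univ]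
  have hlam_pos : ∀ i, i ∈ S₀ → lam i = mu := fun i hi ↦ (hS₀ i).1 hi
  have hlam_neg : ∀ i, i ∉ S₀ → lam i = -mu := fun i hi ↦ (hlam i).resolve_left fun h ↦ hi ((hS₀ i).2 h)
  -- the characters `∏ (x + y λᵢ)` match `(x + y·mu)^N` only at `S₀`
  have hχ : ∀ S : Set.powersetCard (Fin M) N,
      ((fun p : ℕ × ℕ => ∏ i : Fin N, ((p.1 : ℂ) + (p.2 : ℂ) * lam (Set.powersetCard.ofFinEmbEquiv.symm S i))) =
        fun p : ℕ × ℕ => ((p.1 : ℂ) + (p.2 : ℂ) * mu) ^ N) ↔ S = S₀ := by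
    intro S
    constructor
    · intro h
      by_contra hne
      obtain ⟨i, hiS, hiS₀⟩ := (Set.powersetCard.exists_mem_notMem_iff_ne S S₀).1 hne
      obtain ⟨k₀, hk₀⟩ : i ∈ Set.range (Set.powersetCard.ofFinEmbEquiv.symm S) :=
        (Set.powersetCard.mem_range_ofFinEmbEquiv_symm_iff_mem S i).2 hiS
      have hneg : ∃ k, (lam ∘ Set.powersetCard.ofFinEmbEquiv.symm S) k = -mu :=
        ⟨k₀, by rw [Function.comp_apply, hk₀]; exact hlam_neg i hiS₀⟩
      obtain ⟨x, y, hxy⟩ := exists_prod_natCast_add_mul_ne_pow hmu0 (lam ∘ Set.powersetCard.ofFinEmbEquiv.symm S) (fun k => hlam _) hneg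
      exact hxy (congrFun h (x, y))
    · intro hS
      rw [hS]
      funext p
      rw [Finset.prod_congr rfl (fun i _ => by
        rw [hlam_pos _ ((Set.powersetCard.mem_range_ofFinEmbEquiv_symm_iff_mem S₀ _).1 ⟨i, rfl⟩)]),
        Finset.prod_const, Finset.card_univ, Fintype.card_fin]
  ext c
  rw [mem_pullbackEigenclasses_iff]
  have hiff := forall_apply_eq_smul_iff_mem_span_singleton (P := ℕ × ℕ) Bw
    (fun p => (complexBetti.map (p.1 • 𝟙 A + p.2 • φ).hom.hom.hom N).hom)
    (fun S p => ∏ i : Fin N, ((p.1 : ℂ) + (p.2 : ℂ) * lam (Set.powersetCard.ofFinEmbEquiv.symm S i)))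
    hact (fun p => ((p.1 : ℂ) + (p.2 : ℂ) * mu) ^ N) S₀ hχ c
  rw [← hiff]
  exact ⟨fun h p => h p.1 p.2, fun h x y => h (x, y)⟩

/-- **(P0) IS A THEOREM (fact-free)**: for `ψ ≫ ψ = −d`, `d ≥ 1`, on an abelian variety of dimension `N`, the `χ₋`-line of `ψ` IS the
`χ₊`-line of `−ψ` and the `χ₊`-line of `ψ` IS the `χ₋`-line of `−ψ` in degree `N` (both are the wedge line of the `∓i√d`- resp.
`±i√d`-eigenvectors of `ψ^*|H¹`, by `pullbackEigenclasses_pow_eq_span_wedge` applied twice with ONE eigenbasis and `(−ψ)^* = −ψ^*` on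
`H¹`, `complexBetti_map_neg_one`). [cite: vanGeemen1994HodgeAV, 4.9] [cite: LangeBirkenhake1992, §1.1 (p. 19)] -/
theorem kTopLinesNegSwap_of_pos {N d : ℕ} (hd : 0 < d) :
    ∀ (B : AbelianVariety ℂ) (ψ : B ⟶ B), B.dim = N → ψ ≫ ψ = -(d • 𝟙 B) →
      pullbackEigenclasses B ψ N (chiMinus d N) ≤ pullbackEigenclasses B (-ψ) N (chiPlus d N) ∧
        pullbackEigenclasses B ψ N (chiPlus d N) ≤ pullbackEigenclasses B (-ψ) N (chiMinus d N) := by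
  classical
  intro B ψ hB hψ
  haveI := finite_complexBetti_abelianVariety B 1
  have hΛ := Motives.AbelianVariety.hasExteriorCohomologyH1_complexPoints B
  have hb₁ : Module.finrank ℂ (complexBetti B.X 1) = 2 * N := by
    rw [Motives.AbelianVariety.finrank_complexBetti_one, hB]
  set T := (complexBetti.map ψ.hom.hom.hom 1).hom with hT
  have hmu0 : (Complex.I * (Real.sqrt d : ℂ)) ≠ 0 := I_mul_sqrt_ne_zero hd
  have hmu0' : -(Complex.I * (Real.sqrt d : ℂ)) ≠ 0 := neg_ne_zero.mpr hmu0
  have hps : Module.finrank ℂ (Module.End.eigenspace T (Complex.I * (Real.sqrt d : ℂ))) = N := by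
    have h := two_mul_finrank_eigenspace_eq hd hψ
    rw [hb₁] at h
    change 2 * Module.finrank ℂ (Module.End.eigenspace T (Complex.I * (Real.sqrt d : ℂ))) = 2 * N at h
    omega
  have hqs : Module.finrank ℂ (Module.End.eigenspace T (-(Complex.I * (Real.sqrt d : ℂ)))) = N := by
    have h := finrank_eigenspace_eq_finrank_eigenspace_neg hd hψ
    change Module.finrank ℂ (Module.End.eigenspace T (Complex.I * (Real.sqrt d : ℂ))) =
      Module.finrank ℂ (Module.End.eigenspace T (-(Complex.I * (Real.sqrt d : ℂ)))) at h
    rw [← h, hps]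
  have hcompl : IsCompl (Module.End.eigenspace T (Complex.I * (Real.sqrt d : ℂ))) (Module.End.eigenspace T (-(Complex.I * (Real.sqrt d : ℂ)))) :=
    isCompl_eigenspace_eigenspace_neg hd hψ
  -- ONE eigenbasis of `H¹`, the `i√d`-vectors first
  let bp := Module.finBasisOfFinrankEq ℂ (Module.End.eigenspace T (Complex.I * (Real.sqrt d : ℂ))) hps
  let bm := Module.finBasisOfFinrankEq ℂ (Module.End.eigenspace T (-(Complex.I * (Real.sqrt d : ℂ)))) hqs
  let b₀ : Module.Basis (Fin N ⊕ Fin N) ℂ (complexBetti B.X 1) := (bp.prod bm).map (Submodule.prodEquivOfIsCompl _ _ hcompl)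
  let b : Module.Basis (Fin (N + N)) ℂ (complexBetti B.X 1) := b₀.reindex finSumFinEquiv
  let lam : Fin (N + N) → ℂ := fun i =>
    Sum.elim (fun _ => Complex.I * (Real.sqrt d : ℂ)) (fun _ => -(Complex.I * (Real.sqrt d : ℂ))) (finSumFinEquiv.symm i)
  have hlam : ∀ i, lam i = Complex.I * (Real.sqrt d : ℂ) ∨ lam i = -(Complex.I * (Real.sqrt d : ℂ)) := fun i => by
    change Sum.elim _ _ (finSumFinEquiv.symm i) = _ ∨ Sum.elim _ _ (finSumFinEquiv.symm i) = _
    rcases finSumFinEquiv.symm i with k | k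
    · exact Or.inl rfl
    · exact Or.inr rfl
  have hb_mem : ∀ i, b i ∈ Module.End.eigenspace T (lam i) := by
    intro i
    rw [Module.Basis.reindex_apply]
    change b₀ (finSumFinEquiv.symm i) ∈ Module.End.eigenspace T (Sum.elim (fun _ => Complex.I * (Real.sqrt d : ℂ))
      (fun _ => -(Complex.I * (Real.sqrt d : ℂ))) (finSumFinEquiv.symm i))
    rcases finSumFinEquiv.symm i with k | k
    · simp only [Sum.elim_inl, b₀, Module.Basis.map_apply, Module.Basis.prod_apply, Function.comp_apply,
        LinearMap.inl_apply, Submodule.coe_prodEquivOfIsCompl', Submodule.coe_zero, add_zero]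
      exact (bp k).2
    · simp only [Sum.elim_inr, b₀, Module.Basis.map_apply, Module.Basis.prod_apply, Function.comp_apply,
        LinearMap.inr_apply, Submodule.coe_prodEquivOfIsCompl', Submodule.coe_zero, zero_add]
      exact (bm k).2
  -- the SAME basis is a `(−ψ)^*`-eigenbasis with negated eigenvalues (`(−ψ)^* = −ψ^*` on `H¹`)
  have hb_mem' : ∀ i, b i ∈ Module.End.eigenspace (complexBetti.map (-ψ).hom.hom.hom 1).hom (-lam i) := by
    intro i
    have h := Module.End.mem_eigenspace_iff.1 (hb_mem i)
    rw [Module.End.mem_eigenspace_iff, complexBetti_map_neg_one, ModuleCat.hom_neg, LinearMap.neg_apply, neg_smul]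
    exact congrArg Neg.neg h
  -- the two index sets: `S₀` = the `i√d`-indices, `S₁` = the `−i√d`-indices
  let S₀ : Set.powersetCard (Fin (N + N)) N := Set.powersetCard.ofFinEmbEquiv (Fin.castAddOrderEmb N)
  let S₁ : Set.powersetCard (Fin (N + N)) N := Set.powersetCard.ofFinEmbEquiv (Fin.natAddOrderEmb N)
  have hS₀m : ∀ i : Fin (N + N), i ∈ S₀ ↔ ∃ k : Fin N, Fin.castAdd N k = i := by
    intro i
    rw [Set.powersetCard.mem_ofFinEmbEquiv_iff_mem_range]
    rfl
  have hS₁m : ∀ i : Fin (N + N), i ∈ S₁ ↔ ∃ k : Fin N, Fin.natAdd N k = i := by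
    intro i
    rw [Set.powersetCard.mem_ofFinEmbEquiv_iff_mem_range]
    rfl
  have hneq : -(Complex.I * (Real.sqrt d : ℂ)) ≠ Complex.I * (Real.sqrt d : ℂ) := fun h ↦ hmu0 (neg_eq_self.1 h)
  have hS₀ : ∀ i, i ∈ S₀ ↔ lam i = Complex.I * (Real.sqrt d : ℂ) := by
    intro i
    constructor
    · intro hi
      obtain ⟨k, rfl⟩ := (hS₀m i).1 hi
      change Sum.elim _ _ (finSumFinEquiv.symm (Fin.castAdd N k)) = _
      rw [finSumFinEquiv_symm_apply_castAdd, Sum.elim_inl]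
    · intro hi
      by_contra hni
      have h2 : lam i = -(Complex.I * (Real.sqrt d : ℂ)) := by
        change Sum.elim _ _ (finSumFinEquiv.symm i) = _
        generalize hj : finSumFinEquiv.symm i = j
        rcases j with k | k
        · exfalso
          refine hni ((hS₀m i).2 ⟨k, ?_⟩)
          rw [← finSumFinEquiv_apply_left, ← hj, Equiv.apply_symm_apply]
        · rfl
      exact hneq (h2.symm.trans hi)
  have hS₁ : ∀ i, i ∈ S₁ ↔ lam i = -(Complex.I * (Real.sqrt d : ℂ)) := by
    intro i
    constructor
    · intro hi
      obtain ⟨k, rfl⟩ := (hS₁m i).1 hi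
      change Sum.elim _ _ (finSumFinEquiv.symm (Fin.natAdd N k)) = _
      rw [finSumFinEquiv_symm_apply_natAdd, Sum.elim_inr]
    · intro hi
      by_contra hni
      have h2 : lam i = Complex.I * (Real.sqrt d : ℂ) := by
        change Sum.elim _ _ (finSumFinEquiv.symm i) = _
        generalize hj : finSumFinEquiv.symm i = j
        rcases j with k | k
        · rfl
        · exfalso
          refine hni ((hS₁m i).2 ⟨k, ?_⟩)
          rw [← finSumFinEquiv_apply_right, ← hj, Equiv.apply_symm_apply]
      exact hneq (hi.symm.trans h2)
  -- the characters in `(x + y·mu)^N` form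
  have eP : chiPlus d N = fun x y : ℕ ↦ ((x : ℂ) + (y : ℂ) * (Complex.I * (Real.sqrt d : ℂ))) ^ N := by
    funext x y; simp only [chiPlus, mul_assoc]
  have eM : chiMinus d N = fun x y : ℕ ↦ ((x : ℂ) + (y : ℂ) * (-(Complex.I * (Real.sqrt d : ℂ)))) ^ N := by
    funext x y; simp only [chiMinus]; ring
  -- the four lines, all with the ONE basis `b`
  have e1 : (pullbackEigenclasses B ψ N fun x y : ℕ ↦ ((x : ℂ) + (y : ℂ) * (-(Complex.I * (Real.sqrt d : ℂ)))) ^ N) =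
      ℂ ∙ ((b.exteriorPower N).map (hΛ.equiv N)) S₁ :=
    pullbackEigenclasses_pow_eq_span_wedge hΛ hmu0' b lam (fun i ↦ (hlam i).symm.imp_right fun h ↦ h.trans (neg_neg _).symm)
      hb_mem S₁ hS₁
  have e2 : (pullbackEigenclasses B (-ψ) N fun x y : ℕ ↦ ((x : ℂ) + (y : ℂ) * (Complex.I * (Real.sqrt d : ℂ))) ^ N) =
      ℂ ∙ ((b.exteriorPower N).map (hΛ.equiv N)) S₁ :=
    pullbackEigenclasses_pow_eq_span_wedge hΛ hmu0 b (fun i ↦ -lam i)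
      (fun i ↦ (hlam i).symm.imp (fun h ↦ by rw [h, neg_neg]) fun h ↦ by rw [h]) hb_mem' S₁
      fun i ↦ (hS₁ i).trans ⟨fun h ↦ by rw [h, neg_neg], fun h ↦ by rw [← neg_neg (lam i), h]⟩
  have e3 : (pullbackEigenclasses B ψ N fun x y : ℕ ↦ ((x : ℂ) + (y : ℂ) * (Complex.I * (Real.sqrt d : ℂ))) ^ N) =
      ℂ ∙ ((b.exteriorPower N).map (hΛ.equiv N)) S₀ :=
    pullbackEigenclasses_pow_eq_span_wedge hΛ hmu0 b lam hlam hb_mem S₀ hS₀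
  have e4 : (pullbackEigenclasses B (-ψ) N fun x y : ℕ ↦ ((x : ℂ) + (y : ℂ) * (-(Complex.I * (Real.sqrt d : ℂ)))) ^ N) =
      ℂ ∙ ((b.exteriorPower N).map (hΛ.equiv N)) S₀ :=
    pullbackEigenclasses_pow_eq_span_wedge hΛ hmu0' b (fun i ↦ -lam i)
      (fun i ↦ (hlam i).imp (fun h ↦ by rw [h]) fun h ↦ by rw [h, neg_neg]) hb_mem' S₀
      fun i ↦ (hS₀ i).trans ⟨fun h ↦ by rw [h], fun h ↦ neg_injective h⟩
  refine ⟨?_, ?_⟩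
  · rw [eM, eP, e1, e2]
  · rw [eP, eM, e3, e4]

end Summit.HodgeConjecture.HodgeConjecture.Ring2.AbelianAll.OddCell

end
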